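import Literature.RepresentationTheory.Virasoro.FockModule
import Mathlib.RingTheory.MvPolynomial.Symmetric.Defs
import Mathlib.RingTheory.MvPolynomial.WeightedHomogeneous
import Mathlib.Algebra.Ring.GeomSum

/-!
# Singular vectors of Fock modules from screening operators of even integral square

Iohara–Koga §4.3: for `N = β² ∈ 2ℤ_{>0}` the vertex operator `V_β(z)` of the lattice vertex algebra acts
between the Fock modules `F_λ^η` of `Literature.RepresentationTheory.Virasoro.FockModule` by honest formal
LAURENT series, its residue `Σ_β = Res_z V_β(z)` commutes with the Virasoro algebra exactly when
`λ = β/2 - 1/β` (Lemma 4.5: the conformal weight of `V_β` is `1`, so that `[L_n, V_β(z)]` is a total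
derivative, Lemma 4.4), and (Lemma 4.6, eq. (4.11))

  `V_β(z_1) ⋯ V_β(z_r) |η - rβ⟩ = ∏_{i<j} (z_i - z_j)^{β²} ∏_i z_i^{β(η - rβ)} exp(β Σ_{k>0} p_k(z) a_{-k}/k) |η⟩`,

`p_k(z) = Σ_i z_i^k`. Hence the `r`-fold screened vector `Σ_β^r |η - rβ⟩` is the coefficient of a fixed
monomial `z_1^g ⋯ z_r^g` of the POLYNOMIAL family `Δ(z)^{2p} E_N(z) ∈ ℂ[z_1,…,z_r][x_1,x_2,…]` (`β² = 2p`),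
where `E_N` is the level-`N` part of the coherent state `exp(β Σ_k p_k(z) x_k/k)` (the products of the
elementary Schur polynomials of Lemma 4.7). We formalise this directly and algebraically, for EVERY
`p ≥ 1` (no vertex-algebra formalism is needed):

* `Fock.E q N` — the coherent family of a sequence `q` in a commutative `ℂ`-algebra `R`
  (`N E_N = Σ_n q_n x_n E_{N-n}`); the annihilators act diagonally (`d_E`), coefficient derivations act
  by `δE_N = Σ (δq_m/m) x_m E_{N-m}` (`coeffMapₗ_derivation_E`), and — the main computation —
  **`L_pos_E`**: `L_k E_{N+k} = S_k E_N + Σ_m q_{m+k} x_m E_{N-m}` with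
  `S_k = ½ Σ_{0<a<k} q_a q_{k-a} + (μ - λ(k+1)) q_k`, for the Feigin–Fuchs operators `Fock.L R λ μ k`
  with ARBITRARY `λ, μ ∈ R` (Iohara–Koga Lemma 4.4 in coefficient form).
* `Fock.zDer r k = Σ_i z_i^{k+1} ∂_{z_i}` on `ℂ[z_1,…,z_r]`, the Vandermonde product `vand r`, and the
  identities `D_k Δⁿ = n e_k Δⁿ`, `2 e_k = Σ_a p_a p_{k-a} - (k+1) p_k` (`two_mul_eTwo`).
* **`L_screenedFamily`**: for `β² = 2p`, `βλ = p - 1`, `βμ = (r+1)p - (s+1)`, `g = (r-1)p + s`: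
  `L_k (Δ^{2p} E_{N+k}) = D_k(Δ^{2p} E_N) + (k - g) p_k Δ^{2p} E_N` — the coefficient form of
  "`[L_k, V_β(z_1)⋯V_β(z_r)]` is a sum of total `z_i`-derivatives"; extracting the coefficient of
  `z_1^g ⋯ z_r^g` (where a total derivative `z_i^k(z_i∂_i + k - g)` has no such coefficient,
  `coeff_constExp_zDer_add`) gives
* **`screeningVector_singular`**: the screened vector `u = screeningVector r p β g (rs) ∈ F_λ^μ`
  (`c_λ = 13 - 6p - 6/p = c(p)`, `h_λ^μ = h_{r,s}(p)`) satisfies `L_n u = 0` for all `n > 0` and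
  `L_0 u = (h + rs) u` (Iohara–Koga Lemma 4.11, first display, for every `p ≥ 1`).

Its non-vanishing (Iohara–Koga Proposition 4.4, there for odd primes `p` via reduction mod `p`; we
prove it for all `p`) is `Literature.RepresentationTheory.Virasoro.FockSingularVectorsNonzero`.

## References

* [IoharaKoga2011] K. Iohara, Y. Koga, *Representation theory of the Virasoro algebra*, Springer 2011,
  §4.3 (Lemmas 4.4–4.8, Proposition 4.4) and Lemma 4.11.
-/

noncomputable section

namespace Literature.RepresentationTheory.Virasoro

namespace Fock

open MvPolynomial

variable {R : Type*} [CommRing R]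

/-! ### Coefficientwise maps `F(R) → F(R')` -/

section CoeffMap

variable {R' : Type*} [CommRing R'] {S : Type*} [CommSemiring S] [Module S R] [Module S R']

/-- Apply an additive map to every coefficient (in `R`) of a Fock-space polynomial
`v ∈ R[x₁, x₂, …]`. [folklore] -/
def coeffMap (φ : R →+ R') (v : Space R) : Space R' :=
  ∑ t ∈ v.support, monomial t (φ (coeff t v))

/-- The coefficients of `coeffMap φ v` are the images of those of `v`. [folklore] -/
@[simp] theorem coeff_coeffMap (φ : R →+ R') (v : Space R) (t : ℕ+ →₀ ℕ) :
    coeff t (coeffMap φ v) = φ (coeff t v) := by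
  rw [coeffMap, coeff_sum]
  simp only [coeff_monomial]
  rw [Finset.sum_ite_eq']
  split_ifs with h
  · rfl
  · rw [MvPolynomial.mem_support_iff, not_not] at h
    rw [h, map_zero]

/-- `coeffMap` of a linear map, as a linear map. [folklore] -/
def coeffMapₗ (φ : R →ₗ[S] R') : Space R →ₗ[S] Space R' where
  toFun := coeffMap φ.toAddMonoidHom
  map_add' u v := MvPolynomial.ext _ _ fun t => by
    simp only [coeff_coeffMap, coeff_add, LinearMap.toAddMonoidHom_coe, map_add]
  map_smul' s v := MvPolynomial.ext _ _ fun t => by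
    simp only [coeff_coeffMap, coeff_smul, LinearMap.toAddMonoidHom_coe, map_smul, RingHom.id_apply]

/-- The coefficients of `coeffMapₗ φ v`. [folklore] -/
@[simp] theorem coeff_coeffMapₗ (φ : R →ₗ[S] R') (v : Space R) (t : ℕ+ →₀ ℕ) :
    coeff t (coeffMapₗ φ v) = φ (coeff t v) :=
  coeff_coeffMap φ.toAddMonoidHom v t

/-- `coeffMap` of a monomial. [folklore] -/
theorem coeffMapₗ_monomial (φ : R →ₗ[S] R') (u : ℕ+ →₀ ℕ) (a : R) :
    coeffMapₗ φ (monomial u a) = monomial u (φ a) :=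
  MvPolynomial.ext _ _ fun t => by
    simp only [coeff_coeffMapₗ, coeff_monomial]
    split_ifs <;> simp

/-- `coeffMap` commutes with multiplication by a variable. [folklore] -/
theorem coeffMapₗ_X_mul (φ : R →ₗ[S] R') (n : ℕ+) (v : Space R) :
    coeffMapₗ φ (X n * v) = X n * coeffMapₗ φ v :=
  MvPolynomial.ext _ _ fun t => by
    classical
    simp only [coeff_coeffMapₗ, coeff_X_mul']
    split_ifs <;> simp

/-- `coeffMap` commutes with multiplication by the creation letters `x_n`. [folklore] -/
theorem coeffMapₗ_x_mul (φ : R →ₗ[S] R') (n : ℕ) (v : Space R) :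
    coeffMapₗ φ (x R n * v) = x R' n * coeffMapₗ φ v := by
  by_cases hn : 0 < n
  · rw [x_of_pos hn, x_of_pos hn, coeffMapₗ_X_mul]
  · have h0 : n = 0 := by omega
    subst h0
    rw [x_zero, x_zero, zero_mul, zero_mul, map_zero]

/-- `coeffMap` commutes with the partial derivatives `∂_n`. [folklore] -/
theorem coeffMapₗ_pderiv (φ : R →ₗ[S] R') (n : ℕ+) (v : Space R) :
    coeffMapₗ φ (pderiv n v) = pderiv n (coeffMapₗ φ v) :=
  MvPolynomial.ext _ _ fun t => by
    rw [coeff_coeffMapₗ, coeff_pderiv, coeff_pderiv, coeff_coeffMapₗ, ← Nat.cast_succ, ← nsmul_eq_mul',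
      ← Nat.cast_succ, ← nsmul_eq_mul', map_nsmul]

/-- `coeffMap` commutes with the annihilation derivations `d_n`. [folklore] -/
theorem coeffMapₗ_d (φ : R →ₗ[S] R') (n : ℕ) (v : Space R) :
    coeffMapₗ φ (d R n v) = d R' n (coeffMapₗ φ v) := by
  by_cases hn : 0 < n
  · rw [d_of_pos hn, d_of_pos hn, coeffMapₗ_pderiv]
  · have h0 : n = 0 := by omega
    subst h0
    simp [d]

/-- `coeffMap` of `C a * v`, coefficientwise. [folklore] -/
theorem coeff_coeffMapₗ_C_mul (φ : R →ₗ[S] R') (a : R) (v : Space R) (t : ℕ+ →₀ ℕ) :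
    coeff t (coeffMapₗ φ (C a * v)) = φ (a * coeff t v) := by
  rw [coeff_coeffMapₗ, coeff_C_mul]

end CoeffMap

/-! ### Coefficient derivations -/

section CoeffDerivation

variable [Algebra ℂ R]

/-- A derivation `δ` of the coefficient ring acts coefficientwise on `R[x₁, x₂, …]` by a derivation
killing the `x_n`: `δ(C a · v) = C(δ a) · v + C a · δ v`. [folklore] -/
theorem coeffMapₗ_C_mul_of_derivation (δ : Derivation ℂ R R) (a : R) (v : Space R) :
    coeffMapₗ δ.toLinearMap (C a * v) = C (δ a) * v + C a * coeffMapₗ δ.toLinearMap v :=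
  MvPolynomial.ext _ _ fun t => by
    rw [coeff_coeffMapₗ_C_mul, coeff_add, coeff_C_mul, coeff_C_mul, coeff_coeffMapₗ]
    show δ (a * coeff t v) = δ a * coeff t v + a * δ (coeff t v)
    rw [Derivation.leibniz, smul_eq_mul, smul_eq_mul]
    ring

/-- Coefficient derivations kill the scalars from `ℂ`. [folklore] -/
theorem coeffMapₗ_C_algebraMap_mul_of_derivation (δ : Derivation ℂ R R) (s : ℂ) (v : Space R) :
    coeffMapₗ δ.toLinearMap (C (algebraMap ℂ R s) * v) = C (algebraMap ℂ R s) * coeffMapₗ δ.toLinearMap v := by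
  rw [coeffMapₗ_C_mul_of_derivation, Derivation.map_algebraMap, C_0, zero_mul, zero_add]

/-- Coefficient derivations kill the natural numbers. [folklore] -/
theorem coeffMapₗ_C_natCast_mul_of_derivation (δ : Derivation ℂ R R) (n : ℕ) (v : Space R) :
    coeffMapₗ δ.toLinearMap (C (n : R) * v) = C (n : R) * coeffMapₗ δ.toLinearMap v := by
  rw [← map_natCast (algebraMap ℂ R) n, coeffMapₗ_C_algebraMap_mul_of_derivation]

end CoeffDerivation

/-! ### Coefficientwise maps intertwine the Feigin–Fuchs operators with scalar parameters -/

section CoeffMapL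

variable {R' : Type*} [CommRing R'] [Algebra ℂ R] [Algebra ℂ R']

/-- For `λ, μ ∈ ℂ` the operators `L_n` of `F(R)` are the base change of those of `F(ℂ)`, hence
commute with every `ℂ`-linear coefficientwise map. [folklore] -/
theorem coeffMapₗ_L (φ : R →ₗ[ℂ] R') (lam mu : ℂ) (n : ℤ) (v : Space R) :
    coeffMapₗ φ (L R (algebraMap ℂ R lam) (algebraMap ℂ R mu) n v) =
      L R' (algebraMap ℂ R' lam) (algebraMap ℂ R' mu) n (coeffMapₗ φ v) := by
  induction v using MvPolynomial.induction_on' with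
  | monomial u a =>
    -- `monomial u a = C a * (monomial u 1 base-changed from ℂ)`
    set w₀ : Space ℂ := monomial u 1 with hw₀
    have hR : (monomial u a : Space R) = C a * MvPolynomial.map (algebraMap ℂ R) w₀ := by
      rw [hw₀, map_monomial, map_one, C_mul_monomial, mul_one]
    have hR' : (monomial u (φ a) : Space R') = C (φ a) * MvPolynomial.map (algebraMap ℂ R') w₀ := by
      rw [hw₀, map_monomial, map_one, C_mul_monomial, mul_one]
    have hLR : L R (algebraMap ℂ R lam) (algebraMap ℂ R mu) n (MvPolynomial.map (algebraMap ℂ R) w₀) =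
        MvPolynomial.map (algebraMap ℂ R) (L ℂ lam mu n w₀) := by
      have h := map_L (Algebra.ofId ℂ R) lam mu n w₀
      rw [Algebra.ofId_apply, Algebra.ofId_apply] at h
      exact h.symm
    have hLR' : L R' (algebraMap ℂ R' lam) (algebraMap ℂ R' mu) n (MvPolynomial.map (algebraMap ℂ R') w₀) =
        MvPolynomial.map (algebraMap ℂ R') (L ℂ lam mu n w₀) := by
      have h := map_L (Algebra.ofId ℂ R') lam mu n w₀
      rw [Algebra.ofId_apply, Algebra.ofId_apply] at h
      exact h.symm
    set w₁ : Space ℂ := L ℂ lam mu n w₀ with hw₁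
    have h1 : L R (algebraMap ℂ R lam) (algebraMap ℂ R mu) n (C a * MvPolynomial.map (algebraMap ℂ R) w₀) =
        C a * MvPolynomial.map (algebraMap ℂ R) w₁ := by
      rw [← smul_eq_C_mul, (L R _ _ n).map_smul, hLR, smul_eq_C_mul]
    have h2 : L R' (algebraMap ℂ R' lam) (algebraMap ℂ R' mu) n
        (C (φ a) * MvPolynomial.map (algebraMap ℂ R') w₀) = C (φ a) * MvPolynomial.map (algebraMap ℂ R') w₁ := by
      rw [← smul_eq_C_mul, (L R' _ _ n).map_smul, hLR', smul_eq_C_mul]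
    rw [coeffMapₗ_monomial, hR, hR', h1, h2]
    refine MvPolynomial.ext _ _ fun t => ?_
    rw [coeff_coeffMapₗ_C_mul, coeff_C_mul, coeff_map, coeff_map, mul_comm a, ← Algebra.smul_def, map_smul,
      mul_comm (φ a), ← Algebra.smul_def]
  | add p q hp hq => rw [map_add, map_add, hp, hq, ← map_add, ← map_add]

end CoeffMapL

/-! ### The coherent family `E_N` -/

section Coherent

variable [Algebra ℂ R]

variable (R) in
/-- `1/n ∈ R` (`R` is a `ℂ`-algebra; junk value `0` at `n = 0`). [folklore] -/
def ninv (n : ℕ) : R := algebraMap ℂ R ((n : ℂ)⁻¹)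

/-- `n · (1/n) = 1`. [folklore] -/
theorem natCast_mul_ninv {n : ℕ} (hn : n ≠ 0) : (n : R) * ninv R n = 1 := by
  rw [ninv, ← map_natCast (algebraMap ℂ R) n, ← map_mul, mul_inv_cancel₀ (Nat.cast_ne_zero.mpr hn), map_one]

/-- `C(n)` is a unit of `R[x₁, x₂, …]` for `n ≥ 1`. [folklore] -/
theorem isUnit_C_natCast {n : ℕ} (hn : n ≠ 0) : IsUnit (C (n : R) : Space R) :=
  isUnit_iff_exists_inv.mpr ⟨C (ninv R n), by rw [← map_mul, natCast_mul_ninv hn, C_1]⟩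

/-- A sum of terms vanishing beyond `N + 1 - n` is a sum over `range (N + 1 - n)`. [folklore] -/
theorem sum_range_ite_le {M : Type*} [AddCommMonoid M] (N n : ℕ) (f : ℕ → M) :
    ∑ m ∈ Finset.range (N + 1), (if n ≤ N - m then f m else 0) = ∑ m ∈ Finset.range (N + 1 - n), f m := by
  rw [← Finset.sum_range_add_sum_Ico _ (show N + 1 - n ≤ N + 1 by omega)]
  rw [Finset.sum_eq_zero (s := Finset.Ico (N + 1 - n) (N + 1)) fun m hm => ?_, add_zero]
  · refine Finset.sum_congr rfl fun m hm => ?_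
    rw [Finset.mem_range] at hm
    rw [if_pos (by omega)]
  · rw [Finset.mem_Ico] at hm
    rw [if_neg (by omega)]

omit [Algebra ℂ R] in
/-- The `R`-derivations `d_n` pass through `C a ·`. [folklore] -/
theorem d_C_mul (n : ℕ) (a : R) (v : Space R) : d R n (C a * v) = C a * d R n v := by
  rw [← smul_eq_C_mul, ← smul_eq_C_mul, Derivation.map_smul]

variable (q : ℕ → R)

/-- **The coherent family** of a sequence `q = (q_n)_{n ≥ 1}` in `R`: `E_0 = 1` and
`N · E_N = Σ_{n=1}^{N} q_n x_n E_{N-n}`, i.e. `E_N` is the component of `x`-weight `N` of the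
coherent state `exp(Σ_{n ≥ 1} q_n x_n / n)` (for `q_n = β Σ_i z_iⁿ` these are the creation parts of a
product of vertex operators `V_β(z_1) ⋯ V_β(z_r)` applied to the vacuum).
[cite: IoharaKoga2011, §4.3.1 (the vertex operator V_μ(z) = e^{μq} z^{μa_0} exp(μ Σ_{n<0} a_n z^{-n}/(-n)) exp(μ Σ_{n>0} a_n z^{-n}/(-n)))] -/
def E : ℕ → Space R
  | 0 => 1
  | N + 1 => C (ninv R (N + 1)) * ∑ m ∈ Finset.range (N + 1), C (q (m + 1)) * x R (m + 1) * E (N - m)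
  termination_by N => N
  decreasing_by omega

/-- `E_0 = 1`. [folklore] -/
@[simp] theorem E_zero : E q 0 = 1 := by
  rw [E]

/-- The defining recursion. [folklore] -/
theorem E_succ (N : ℕ) :
    E q (N + 1) = C (ninv R (N + 1)) * ∑ m ∈ Finset.range (N + 1), C (q (m + 1)) * x R (m + 1) * E q (N - m) := by
  rw [E]

/-- The recursion in the uniform form `N · E_N = Σ_{m < N} q_{m+1} x_{m+1} E_{N-1-m}` (all `N`). [folklore] -/
theorem C_natCast_mul_E (N : ℕ) :
    C (N : R) * E q N = ∑ m ∈ Finset.range N, C (q (m + 1)) * x R (m + 1) * E q (N - 1 - m) := by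
  cases N with
  | zero => simp
  | succ N =>
    rw [E_succ, ← mul_assoc, ← map_mul, natCast_mul_ninv (Nat.succ_ne_zero N), C_1, one_mul]
    refine Finset.sum_congr rfl fun m _ => ?_
    rw [Nat.add_sub_cancel]

/-- **Annihilators act diagonally on the coherent family**: `∂_n E_N = (q_n / n) E_{N-n}`
(`1 ≤ n ≤ N`; zero for `n > N`), i.e. `a_n exp(Σ q_m x_m/m) = q_n exp(Σ q_m x_m/m)`.
[cite: IoharaKoga2011, §4.3.1 (commutation of a_n with the vertex operator, Lemma 4.4)] -/
theorem d_E {n : ℕ} (hn : 0 < n) (N : ℕ) :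
    d R n (E q N) = if n ≤ N then C (ninv R n * q n) * E q (N - n) else 0 := by
  induction N using Nat.strong_induction_on with
  | _ N ih =>
  cases N with
  | zero => rw [E_zero, Derivation.map_one_eq_zero, if_neg (by omega)]
  | succ N =>
    rw [← (isUnit_C_natCast (R := R) (n := N + 1) (by omega)).mul_right_inj, ← d_C_mul, C_natCast_mul_E,
      map_sum]
    -- differentiate the recursion termwise
    have hterm : ∀ m ∈ Finset.range (N + 1),
        d R n (C (q (m + 1)) * x R (m + 1) * E q (N + 1 - 1 - m)) =
          (if n ≤ N - m then C (q (m + 1)) * x R (m + 1) * (C (ninv R n * q n) * E q (N - m - n)) else 0) +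
            (if n - 1 = m then C (q n) * E q (N + 1 - n) else 0) := by
      intro m hm
      rw [Finset.mem_range] at hm
      rw [show N + 1 - 1 - m = N - m by omega, mul_assoc, d_C_mul, Derivation.leibniz, smul_eq_mul,
        smul_eq_mul, d_x, ih (N - m) (by omega), mul_add]
      congr 1
      · split_ifs with h
        · rw [mul_assoc]
        · rw [mul_zero, mul_zero]
      · by_cases h : n = m + 1
        · rw [if_pos ⟨h, Nat.succ_pos m⟩, if_pos (by omega), mul_one, h, show N + 1 - (m + 1) = N - m by omega]
        · rw [if_neg (fun h' => h h'.1), if_neg (by omega), mul_zero, mul_zero]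
    rw [Finset.sum_congr rfl hterm, Finset.sum_add_distrib, sum_range_ite_le, Finset.sum_ite_eq]
    by_cases hle : n ≤ N + 1
    · rw [if_pos (Finset.mem_range.mpr (by omega)), if_pos hle]
      -- the first sum is `(q_n/n) (N + 1 - n) E_{N+1-n}` by the recursion
      have h2 : ∑ m ∈ Finset.range (N + 1 - n), C (q (m + 1)) * x R (m + 1) * (C (ninv R n * q n) * E q (N - m - n)) =
          C (ninv R n * q n) * (C ((N + 1 - n : ℕ) : R) * E q (N + 1 - n)) := by
        rw [C_natCast_mul_E, Finset.mul_sum]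
        refine Finset.sum_congr rfl fun m hm => ?_
        rw [show N + 1 - n - 1 - m = N - m - n by omega]
        ring
      have eL : C (ninv R n * q n) * (C ((N + 1 - n : ℕ) : R) * E q (N + 1 - n)) + C (q n) * E q (N + 1 - n) =
          C (ninv R n * q n * ((N + 1 - n : ℕ) : R) + q n) * E q (N + 1 - n) := by
        simp only [map_add, map_mul]; ring
      have eR : C ((N + 1 : ℕ) : R) * (C (ninv R n * q n) * E q (N + 1 - n)) =
          C (((N + 1 : ℕ) : R) * (ninv R n * q n)) * E q (N + 1 - n) := by
        simp only [map_mul]; ring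
      rw [h2, eL, eR]
      congr 2
      have h1 := natCast_mul_ninv (R := R) (n := n) (by omega)
      rw [Nat.cast_sub hle]
      push_cast
      linear_combination (-(q n)) * h1
    · rw [if_neg (fun h => hle (by rw [Finset.mem_range] at h; omega)), if_neg hle, mul_zero, add_zero,
        show N + 1 - n = 0 by omega, Finset.sum_range_zero]

/-- Coefficient derivations kill `E_0 = 1`. [folklore] -/
theorem coeffMapₗ_derivation_one (δ : Derivation ℂ R R) : coeffMapₗ δ.toLinearMap (1 : Space R) = 0 :=
  MvPolynomial.ext _ _ fun t => by
    rw [coeff_coeffMapₗ, coeff_one, coeff_zero]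
    show δ _ = 0
    split_ifs
    · exact δ.map_one_eq_zero
    · exact map_zero δ

/-- **Coefficient derivations of the coherent family**: for a derivation `δ` of `R`,
`δ E_N = Σ_{m=1}^{N} (δ q_m / m) x_m E_{N-m}` (`δ exp(Σ q_m x_m/m) = (Σ δq_m x_m/m) exp(⋯)`). [folklore] -/
theorem coeffMapₗ_derivation_E (δ : Derivation ℂ R R) (N : ℕ) :
    coeffMapₗ δ.toLinearMap (E q N) =
      ∑ m ∈ Finset.range N, C (ninv R (m + 1) * δ (q (m + 1))) * x R (m + 1) * E q (N - 1 - m) := by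
  induction N using Nat.strong_induction_on with
  | _ N ih =>
  cases N with
  | zero => rw [E_zero, Finset.sum_range_zero, coeffMapₗ_derivation_one]
  | succ N =>
    rw [← (isUnit_C_natCast (R := R) (n := N + 1) (by omega)).mul_right_inj,
      ← coeffMapₗ_C_natCast_mul_of_derivation, C_natCast_mul_E, map_sum]
    have hterm : ∀ m ∈ Finset.range (N + 1),
        coeffMapₗ δ.toLinearMap (C (q (m + 1)) * x R (m + 1) * E q (N + 1 - 1 - m)) =
          C (δ (q (m + 1))) * x R (m + 1) * E q (N - m) +
            C (q (m + 1)) * x R (m + 1) * ∑ j ∈ Finset.range (N - m),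
              C (ninv R (j + 1) * δ (q (j + 1))) * x R (j + 1) * E q (N - m - 1 - j) := by
      intro m hm
      rw [show N + 1 - 1 - m = N - m by omega, mul_assoc, coeffMapₗ_C_mul_of_derivation, coeffMapₗ_x_mul,
        ih (N - m) (by rw [Finset.mem_range] at hm; omega), mul_assoc, mul_assoc]
    rw [Finset.sum_congr rfl hterm, Finset.sum_add_distrib]
    -- swap the double sum and use the recursion for the inner sums
    have hswap : ∑ m ∈ Finset.range (N + 1), C (q (m + 1)) * x R (m + 1) *
          ∑ j ∈ Finset.range (N - m), C (ninv R (j + 1) * δ (q (j + 1))) * x R (j + 1) * E q (N - m - 1 - j) =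
        ∑ j ∈ Finset.range (N + 1), C (ninv R (j + 1) * δ (q (j + 1))) * x R (j + 1) *
          (C ((N - j : ℕ) : R) * E q (N - j)) := by
      simp_rw [Finset.mul_sum]
      rw [Finset.sum_comm' (t' := Finset.range (N + 1)) (s' := fun j => Finset.range (N - j))]
      · refine Finset.sum_congr rfl fun j hj => ?_
        rw [C_natCast_mul_E, Finset.mul_sum]
        refine Finset.sum_congr rfl fun m hm => ?_
        rw [show N - j - 1 - m = N - m - 1 - j by omega]
        ring
      · intro m j
        simp only [Finset.mem_range]
        omega
    rw [hswap, ← Finset.sum_add_distrib, Finset.mul_sum]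
    refine Finset.sum_congr rfl fun j hj => ?_
    rw [Finset.mem_range] at hj
    rw [show N + 1 - 1 - j = N - j by omega]
    have h1 := natCast_mul_ninv (R := R) (n := j + 1) (by omega)
    have eL : C (δ (q (j + 1))) * x R (j + 1) * E q (N - j) +
        C (ninv R (j + 1) * δ (q (j + 1))) * x R (j + 1) * (C ((N - j : ℕ) : R) * E q (N - j)) =
        C (δ (q (j + 1)) + ninv R (j + 1) * δ (q (j + 1)) * ((N - j : ℕ) : R)) * (x R (j + 1) * E q (N - j)) := by
      simp only [map_add, map_mul]; ring
    have eR : C ((N + 1 : ℕ) : R) * (C (ninv R (j + 1) * δ (q (j + 1))) * x R (j + 1) * E q (N - j)) =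
        C (((N + 1 : ℕ) : R) * (ninv R (j + 1) * δ (q (j + 1)))) * (x R (j + 1) * E q (N - j)) := by
      simp only [map_mul]; ring
    rw [eL, eR]
    congr 2
    rw [Nat.cast_sub (by omega)]
    push_cast at h1 ⊢
    linear_combination (-(δ (q (j + 1)))) * h1

end Coherent

/-! ### The raising operators on the coherent family -/

section LAction

variable [Algebra ℂ R] (lam mu : R)

omit [Algebra ℂ R] in
/-- `a_{-n} = x_n ·` (`n ≥ 1`). [cite: IoharaKoga2011, Lemma 4.3] -/
theorem a_neg_nat {n : ℕ} (hn : 0 < n) : a R mu (-(n : ℤ)) = m (x R n) := by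
  have h := a_neg (R := R) mu ⟨n, hn⟩
  rw [PNat.mk_coe] at h
  rw [h, x_of_pos hn]

omit [Algebra ℂ R] in
/-- `a_n = n ∂_n` (`n ≥ 1`). [cite: IoharaKoga2011, Lemma 4.3] -/
theorem a_pos_nat {n : ℕ} (hn : 0 < n) :
    a R mu (n : ℤ) = (n : R) • (d R n : Module.End R (Space R)) := by
  have h := a_pos (R := R) mu ⟨n, hn⟩
  rw [PNat.mk_coe] at h
  rw [h, d_of_pos hn]

/-- `L_k` is `R`-linear: it passes through `C a ·`. [folklore] -/
theorem L_C_mul (k : ℤ) (a : R) (v : Space R) : L R lam mu k (C a * v) = C a * L R lam mu k v := by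
  rw [← smul_eq_C_mul, ← smul_eq_C_mul, LinearMap.map_smul]

/-- **`[L_k, a_{-n}] = n a_{k-n} - λ k(k+1) δ_{k,n}`** applied to a vector:
`L_k (x_n v) = x_n L_k v + n a_{k-n} v - δ_{k,n} λ k (k+1) v`. [cite: IoharaKoga2011, Lemma 4.4] -/
theorem L_x_mul (k : ℤ) {n : ℕ} (hn : 0 < n) (v : Space R) :
    L R lam mu k (x R n * v) =
      x R n * L R lam mu k v + (n : R) • a R mu (k - n) v - (if k = n then lam * k * (k + 1) else 0) • v := by
  have h := LinearMap.congr_fun (L_mul_a_sub lam mu k (-(n : ℤ))) v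
  simp only [LinearMap.sub_apply, Module.End.mul_apply, B, LinearMap.smul_apply, Module.End.one_apply,
    a_neg_nat mu hn, LinearMap.mulLeft_apply] at h
  rw [sub_eq_iff_eq_add'] at h
  rw [h, Int.cast_neg, Int.cast_natCast, neg_neg, ← sub_eq_add_neg, add_sub_assoc]
  congr 3
  by_cases hk : k = n
  · rw [if_pos (by omega), if_pos hk]
  · rw [if_neg (by omega), if_neg hk]

variable (q : ℕ → R)

/-- `a_{k-n} E_M`: an annihilator (`n < k`, acting diagonally by `d_E`), the momentum
`μ` (`n = k`) or a creation letter (`n > k`). [folklore] -/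
theorem a_sub_E (k n M : ℕ) :
    a R mu ((k : ℤ) - (n : ℤ)) (E q M) =
      (if n < k then (if k - n ≤ M then C (q (k - n)) * E q (M - (k - n)) else 0) else 0) +
        (if n = k then mu • E q M else 0) + (if k < n then x R (n - k) * E q M else 0) := by
  rcases lt_trichotomy n k with h | rfl | h
  · rw [show (k : ℤ) - (n : ℤ) = ((k - n : ℕ) : ℤ) by omega, a_pos_nat mu (by omega), LinearMap.smul_apply,
      Derivation.coeFn_coe, d_E q (by omega), if_pos h, if_neg h.ne, if_neg (not_lt.mpr h.le), add_zero, add_zero]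
    split_ifs with h'
    · rw [smul_eq_C_mul, ← mul_assoc, ← map_mul, ← mul_assoc, natCast_mul_ninv (by omega), one_mul]
    · rw [smul_zero]
  · rw [sub_self, a_zero, if_neg (lt_irrefl n), if_pos rfl, if_neg (lt_irrefl n), zero_add, add_zero,
      LinearMap.smul_apply, Module.End.one_apply]
  · rw [show (k : ℤ) - (n : ℤ) = -((n - k : ℕ) : ℤ) by omega, a_neg_nat mu (by omega), LinearMap.mulLeft_apply,
      if_neg (not_lt.mpr h.le), if_neg h.ne', if_pos h, zero_add, zero_add]

/-- `Σ_{m < L} [m + 1 < k] g(m) = Σ_{m < k - 1} g(m)` for `k - 1 ≤ L`. [folklore] -/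
theorem sum_range_ite_succ_lt {M : Type*} [AddCommMonoid M] {L k : ℕ} (hkL : k - 1 ≤ L) (g : ℕ → M) :
    ∑ m ∈ Finset.range L, (if m + 1 < k then g m else 0) = ∑ m ∈ Finset.range (k - 1), g m := by
  rw [← Finset.sum_range_add_sum_Ico _ hkL]
  rw [Finset.sum_eq_zero (s := Finset.Ico (k - 1) L) fun m hm => ?_, add_zero]
  · refine Finset.sum_congr rfl fun m hm => ?_
    rw [Finset.mem_range] at hm
    rw [if_pos (by omega)]
  · rw [Finset.mem_Ico] at hm
    rw [if_neg (by omega)]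

/-- `Σ_{m < L} [m + 1 = k] g(m) = [k - 1 < L] g(k - 1)` for `k ≥ 1`. [folklore] -/
theorem sum_range_ite_succ_eq {M : Type*} [AddCommMonoid M] (L : ℕ) {k : ℕ} (hk : 0 < k) (g : ℕ → M) :
    ∑ m ∈ Finset.range L, (if m + 1 = k then g m else 0) = if k - 1 < L then g (k - 1) else 0 := by
  have h : ∀ m ∈ Finset.range L, (if m + 1 = k then g m else 0) = if k - 1 = m then g m else 0 := by
    intro m _
    by_cases hm : m + 1 = k
    · rw [if_pos hm, if_pos (by omega)]
    · rw [if_neg hm, if_neg (by omega)]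
  rw [Finset.sum_congr rfl h, Finset.sum_ite_eq]
  by_cases hkL : k - 1 < L
  · rw [if_pos (Finset.mem_range.mpr hkL), if_pos hkL]
  · rw [if_neg (fun h' => hkL (Finset.mem_range.mp h')), if_neg hkL]

/-- `Σ_{m < L} [k < m + 1] g(m) = Σ_{j < L - k} g(k + j)`. [folklore] -/
theorem sum_range_ite_lt_succ {M : Type*} [AddCommMonoid M] (L k : ℕ) (g : ℕ → M) :
    ∑ m ∈ Finset.range L, (if k < m + 1 then g m else 0) = ∑ j ∈ Finset.range (L - k), g (k + j) := by
  by_cases hkL : k ≤ L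
  · rw [← Finset.sum_range_add_sum_Ico _ hkL, Finset.sum_eq_zero (s := Finset.range k) fun m hm => ?_, zero_add,
      Finset.sum_Ico_eq_sum_range]
    · refine Finset.sum_congr rfl fun j _ => ?_
      rw [if_pos (by omega)]
    · rw [Finset.mem_range] at hm
      rw [if_neg (by omega)]
  · rw [show L - k = 0 by omega, Finset.sum_range_zero]
    refine Finset.sum_eq_zero fun m hm => ?_
    rw [Finset.mem_range] at hm
    rw [if_neg (by omega)]

/-- The scalar `S_k = ½ Σ_{0<a<k} q_a q_{k-a} + (μ - λ(k+1)) q_k` of `L_k` on the coherent state.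
[cite: IoharaKoga2011, Lemma 4.4 (adjoint action of L_n on vertex operators)] -/
def coherentScalar (k : ℕ) : R :=
  half R * (∑ i ∈ Finset.range (k - 1), q (i + 1) * q (k - 1 - i)) + (mu - lam * (k + 1)) * q k

/-- **The raising operators on the coherent family**: for `k ≥ 1`,
`L_k E_{N+k} = S_k E_N + Σ_{m ≥ 1} q_{m+k} x_m E_{N-m}` and `L_k E_M = 0` for `M < k`
(`L_k exp(Σ q_n x_n/n)|μ⟩ = (S_k + Σ_m q_{m+k} x_m) exp(Σ q_n x_n/n)|μ⟩`).
[cite: IoharaKoga2011, Lemma 4.4 and §4.3.1] -/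
theorem L_pos_E {k : ℕ} (hk : 0 < k) (M : ℕ) :
    L R lam mu k (E q M) =
      if k ≤ M then C (coherentScalar lam mu q k) * E q (M - k) +
        ∑ j ∈ Finset.range (M - k), C (q (j + 1 + k)) * x R (j + 1) * E q (M - k - 1 - j)
      else 0 := by
  induction M using Nat.strong_induction_on with
  | _ M ih =>
  cases M with
  | zero => rw [E_zero, L_pos_one lam mu (by exact_mod_cast hk), if_neg (by omega)]
  | succ M =>
    rw [← (isUnit_C_natCast (R := R) (n := M + 1) (by omega)).mul_right_inj, ← L_C_mul, C_natCast_mul_E,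
      map_sum]
    -- `L_k` on each term of the recursion: `L_k (q x E) = q (x L_k E + (m+1) a_{k-m-1} E - δ λk(k+1) E)`
    have hterm : ∀ m ∈ Finset.range (M + 1),
        L R lam mu k (C (q (m + 1)) * x R (m + 1) * E q (M + 1 - 1 - m)) =
          (if k ≤ M - m then C (q (m + 1)) * x R (m + 1) * (C (coherentScalar lam mu q k) * E q (M - m - k) +
              ∑ j ∈ Finset.range (M - m - k), C (q (j + 1 + k)) * x R (j + 1) * E q (M - m - k - 1 - j)) else 0) +
          ((if m + 1 < k then
              (if k ≤ M + 1 then C (q (m + 1) * (m + 1) * q (k - 1 - m)) * E q (M + 1 - k) else 0) else 0) +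
            (if m + 1 = k then C (q k * k * mu) * E q (M + 1 - k) else 0) +
            (if k < m + 1 then C (q (m + 1) * (m + 1)) * (x R (m + 1 - k) * E q (M - m)) else 0)) -
          (if m + 1 = k then C (q k * (lam * k * (k + 1))) * E q (M + 1 - k) else 0) := by
      intro m hm
      rw [Finset.mem_range] at hm
      -- the three pieces
      have eA : C (q (m + 1)) * (x R (m + 1) * L R lam mu k (E q (M - m))) =
          (if k ≤ M - m then C (q (m + 1)) * x R (m + 1) * (C (coherentScalar lam mu q k) * E q (M - m - k) +
              ∑ j ∈ Finset.range (M - m - k), C (q (j + 1 + k)) * x R (j + 1) * E q (M - m - k - 1 - j)) else 0) := by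
        rw [ih (M - m) (by omega)]
        split_ifs with h
        · rw [mul_assoc]
        · rw [mul_zero, mul_zero]
      have eB : C (q (m + 1)) * (((m + 1 : ℕ) : R) • a R mu ((k : ℤ) - ((m + 1 : ℕ) : ℤ)) (E q (M - m))) =
          (if m + 1 < k then
              (if k ≤ M + 1 then C (q (m + 1) * (m + 1) * q (k - 1 - m)) * E q (M + 1 - k) else 0) else 0) +
            (if m + 1 = k then C (q k * k * mu) * E q (M + 1 - k) else 0) +
            (if k < m + 1 then C (q (m + 1) * (m + 1)) * (x R (m + 1 - k) * E q (M - m)) else 0) := by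
        rw [a_sub_E mu q k (m + 1) (M - m), smul_add, smul_add, mul_add (C (q (m + 1))),
          mul_add (C (q (m + 1)))]
        congr 2
        · by_cases h : m + 1 < k
          · rw [if_pos h, if_pos h]
            by_cases h' : k ≤ M + 1
            · rw [if_pos (show k - (m + 1) ≤ M - m by omega), if_pos h',
                show M - m - (k - (m + 1)) = M + 1 - k by omega, show k - (m + 1) = k - 1 - m by omega]
              simp only [smul_eq_C_mul, map_mul, map_natCast, map_add, map_one]
              push_cast
              ring
            · rw [if_neg (show ¬(k - (m + 1) ≤ M - m) by omega), if_neg h', smul_zero, mul_zero]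
          · rw [if_neg h, if_neg h, smul_zero, mul_zero]
        · by_cases h : m + 1 = k
          · rw [if_pos h, if_pos h, show M - m = M + 1 - k by omega, ← h]
            simp only [smul_eq_C_mul, map_mul, map_natCast]
            push_cast
            ring
          · rw [if_neg h, if_neg h, smul_zero, mul_zero]
        · by_cases h : k < m + 1
          · rw [if_pos h, if_pos h]
            simp only [smul_eq_C_mul, map_mul, map_natCast, map_add, map_one]
            push_cast
            ring
          · rw [if_neg h, if_neg h, smul_zero, mul_zero]
      have eC : C (q (m + 1)) * ((if (k : ℤ) = ((m + 1 : ℕ) : ℤ) then lam * ((k : ℤ) : R) * (((k : ℤ) : R) + 1) else 0) •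
            E q (M - m)) =
          (if m + 1 = k then C (q k * (lam * k * (k + 1))) * E q (M + 1 - k) else 0) := by
        by_cases h : m + 1 = k
        · rw [if_pos (by exact_mod_cast h.symm), if_pos h, show M - m = M + 1 - k by omega, ← h]
          simp only [smul_eq_C_mul, map_mul]
          push_cast
          ring
        · rw [if_neg (fun h' => h (by exact_mod_cast h'.symm)), if_neg h, zero_smul, mul_zero]
      rw [show M + 1 - 1 - m = M - m by omega, mul_assoc, L_C_mul, L_x_mul lam mu k (by omega : 0 < m + 1),
        mul_sub (C (q (m + 1))), mul_add (C (q (m + 1))), eA, eB, eC]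
    rw [Finset.sum_congr rfl hterm, Finset.sum_sub_distrib, Finset.sum_add_distrib, Finset.sum_add_distrib,
      Finset.sum_add_distrib, sum_range_ite_le, sum_range_ite_succ_eq _ hk, sum_range_ite_succ_eq _ hk,
      sum_range_ite_lt_succ]
    by_cases hkM : k ≤ M + 1
    · simp only [if_pos hkM, if_pos (show k - 1 < M + 1 by omega)]
      rw [sum_range_ite_succ_lt (show k - 1 ≤ M + 1 by omega)]
      obtain ⟨N, hN⟩ : ∃ N, M + 1 - k = N := ⟨_, rfl⟩
      rw [hN]
      set S := coherentScalar lam mu q k with hS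
      set Q := ∑ i ∈ Finset.range (k - 1), q (i + 1) * q (k - 1 - i) with hQ
      -- (1) the first sum: `S · N E_N` plus a double sum, swapped and resummed by the recursion
      have h1 : ∑ m ∈ Finset.range N, C (q (m + 1)) * x R (m + 1) * (C S * E q (M - m - k) +
            ∑ j ∈ Finset.range (M - m - k), C (q (j + 1 + k)) * x R (j + 1) * E q (M - m - k - 1 - j)) =
          C S * (C (N : R) * E q N) + ∑ j ∈ Finset.range (N - 1),
            C (q (j + 1 + k)) * x R (j + 1) * (C ((N - 1 - j : ℕ) : R) * E q (N - 1 - j)) := by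
        simp_rw [mul_add, Finset.sum_add_distrib]
        congr 1
        · rw [C_natCast_mul_E, Finset.mul_sum]
          refine Finset.sum_congr rfl fun m hm => ?_
          rw [show M - m - k = N - 1 - m by omega]
          ring
        · simp_rw [Finset.mul_sum]
          rw [Finset.sum_comm' (t' := Finset.range (N - 1)) (s' := fun j => Finset.range (N - 1 - j))]
          · refine Finset.sum_congr rfl fun j hj => ?_
            rw [C_natCast_mul_E, Finset.mul_sum]
            refine Finset.sum_congr rfl fun m hm => ?_
            rw [Finset.mem_range] at hm hj
            rw [show M - m - k - 1 - j = N - 1 - j - 1 - m by omega]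
            ring
          · intro m j
            simp only [Finset.mem_range]
            omega
      -- (2) symmetrisation of the annihilator–annihilator term
      have h2 : ∑ m ∈ Finset.range (k - 1), C (q (m + 1) * (m + 1) * q (k - 1 - m)) * E q N =
          C (half R * k * Q) * E q N := by
        rw [← Finset.sum_mul, ← map_sum]
        have hT : (2 : R) * ∑ m ∈ Finset.range (k - 1), q (m + 1) * (m + 1) * q (k - 1 - m) = k * Q := by
          rw [two_mul]
          nth_rewrite 1 [← Finset.sum_range_reflect]
          rw [← Finset.sum_add_distrib, hQ, Finset.mul_sum]
          refine Finset.sum_congr rfl fun m hm => ?_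
          rw [Finset.mem_range] at hm
          rw [show k - 1 - (k - 1 - 1 - m) = m + 1 by omega, show k - 1 - 1 - m + 1 = k - 1 - m by omega]
          have e : ((k - 1 - 1 - m : ℕ) : R) + 1 = k - (m + 1) := by
            rw [Nat.cast_sub (by omega), Nat.cast_sub (by omega), Nat.cast_sub (by omega)]; push_cast; ring
          rw [e]
          ring
        have hT' : ∑ m ∈ Finset.range (k - 1), q (m + 1) * (m + 1) * q (k - 1 - m) = half R * k * Q := by
          calc ∑ m ∈ Finset.range (k - 1), q (m + 1) * (m + 1) * q (k - 1 - m)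
              = half R * ((2 : R) * ∑ m ∈ Finset.range (k - 1), q (m + 1) * (m + 1) * q (k - 1 - m)) := by
                rw [← mul_assoc, mul_comm (half R), two_mul_half, one_mul]
            _ = half R * k * Q := by rw [hT, mul_assoc]
        rw [hT']
      -- (3) the creation term, reindexed
      have h3 : ∑ j ∈ Finset.range N, C (q (k + j + 1) * (↑(k + j) + 1)) * (x R (k + j + 1 - k) * E q (M - (k + j))) =
          ∑ j ∈ Finset.range N, C (q (j + 1 + k) * ((N : R) + k - ((N - 1 - j : ℕ) : R))) * x R (j + 1) * E q (N - 1 - j) := by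
        refine Finset.sum_congr rfl fun j hj => ?_
        rw [Finset.mem_range] at hj
        rw [show k + j + 1 - k = j + 1 by omega, show M - (k + j) = N - 1 - j by omega, show k + j + 1 = j + 1 + k by omega,
          mul_assoc]
        congr 2
        rw [Nat.cast_sub (by omega), Nat.cast_sub (by omega), ← hN, Nat.cast_sub hkM]
        push_cast
        ring
      -- (4) extend the second sum of (1) to `range N` (the added term has the factor `C 0`)
      have h4 : ∑ j ∈ Finset.range (N - 1), C (q (j + 1 + k)) * x R (j + 1) * (C ((N - 1 - j : ℕ) : R) * E q (N - 1 - j)) =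
          ∑ j ∈ Finset.range N, C (q (j + 1 + k)) * x R (j + 1) * (C ((N - 1 - j : ℕ) : R) * E q (N - 1 - j)) := by
        rcases Nat.eq_zero_or_pos N with h0 | hpos
        · rw [h0]
        · obtain ⟨N', rfl⟩ : ∃ N', N = N' + 1 := ⟨N - 1, by omega⟩
          rw [Finset.sum_range_succ, Nat.add_sub_cancel, Nat.sub_self, Nat.cast_zero, C_0, zero_mul, mul_zero,
            add_zero]
      rw [h1, h2, h3, h4]
      have hNk : (N : R) + k = ((M + 1 : ℕ) : R) := by
        rw [← hN, Nat.cast_sub hkM]; push_cast; ring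
      -- the `x_{j+1} E_{N-1-j}` terms
      have hsum : ∑ j ∈ Finset.range N, C (q (j + 1 + k)) * x R (j + 1) * (C ((N - 1 - j : ℕ) : R) * E q (N - 1 - j)) +
            ∑ j ∈ Finset.range N, C (q (j + 1 + k) * (↑N + ↑k - ((N - 1 - j : ℕ) : R))) * x R (j + 1) * E q (N - 1 - j) =
          C ((M + 1 : ℕ) : R) * ∑ j ∈ Finset.range N, C (q (j + 1 + k)) * x R (j + 1) * E q (N - 1 - j) := by
        rw [Finset.mul_sum, ← Finset.sum_add_distrib]
        refine Finset.sum_congr rfl fun j _ => ?_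
        rw [← hNk]
        simp only [map_add, map_mul, map_sub, map_natCast]
        ring
      -- the `E_N` terms
      have hE : C S * (C (N : R) * E q N) + (C (half R * ↑k * Q) * E q N + C (q k * ↑k * mu) * E q N) -
            C (q k * (lam * ↑k * (↑k + 1))) * E q N = C ((M + 1 : ℕ) : R) * (C S * E q N) := by
        rw [← hNk, hS, coherentScalar, ← hQ]
        simp only [map_add, map_mul, map_sub, map_natCast, map_one]
        ring
      rw [mul_add (C ((M + 1 : ℕ) : R)), ← hsum, ← hE]
      abel
    · simp only [if_neg hkM, if_neg (show ¬(k - 1 < M + 1) by omega), show M + 1 - k = 0 by omega,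
        Finset.sum_range_zero, ite_self, Finset.sum_const_zero, mul_zero, add_zero, sub_zero]

end LAction

/-! ### The Euler derivations `Σ_i z_i^{k+1} ∂_{z_i}` of `ℂ[z_1, …, z_r]` and the Vandermonde powers -/

section ZRing

variable {r : ℕ}

/-- The coefficient ring `ℂ[z_1, …, z_r]` of the positions of `r` screening currents. [folklore] -/
abbrev ZRing (r : ℕ) : Type := MvPolynomial (Fin r) ℂ

/-- The derivation `D_k = Σ_i z_i^{k+1} ∂_{z_i}` of `ℂ[z_1, …, z_r]` (the action of `-ℓ_k` on
functions of the positions). [folklore] -/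
def zDer (r k : ℕ) : Derivation ℂ (ZRing r) (ZRing r) := mkDerivation ℂ fun i => X i ^ (k + 1)

/-- `D_k z_i = z_i^{k+1}`. [folklore] -/
@[simp] theorem zDer_X (k : ℕ) (i : Fin r) : zDer r k (X i) = X i ^ (k + 1) :=
  mkDerivation_X _ _ _

/-- `D_k (z_iⁿ) = n z_i^{n+k}`. [folklore] -/
theorem zDer_X_pow (k : ℕ) (i : Fin r) (n : ℕ) : zDer r k (X i ^ n) = (n : ZRing r) * X i ^ (n + k) := by
  rw [Derivation.leibniz_pow, zDer_X, smul_eq_mul, nsmul_eq_mul]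
  rcases Nat.eq_zero_or_pos n with rfl | hn
  · simp
  · rw [← pow_add, show n - 1 + (k + 1) = n + k by omega]

/-- `D_k (p_n) = n p_{n+k}` on the power sums `p_n = Σ_i z_iⁿ`. [folklore] -/
theorem zDer_psum (k n : ℕ) : zDer r k (psum (Fin r) ℂ n) = (n : ZRing r) * psum (Fin r) ℂ (n + k) := by
  simp only [psum, map_sum, zDer_X_pow, Finset.mul_sum]

/-- The complete homogeneous polynomial `h_k(z_a, z_b) = Σ_{e=0}^{k} z_a^e z_b^{k-e}` of two of the
variables. [folklore] -/
def hTwo (k : ℕ) (a b : Fin r) : ZRing r := ∑ e ∈ Finset.range (k + 1), X a ^ e * X b ^ (k - e)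

/-- `D_k (z_a - z_b) = z_a^{k+1} - z_b^{k+1} = (z_a - z_b) h_k(z_a, z_b)`. [folklore] -/
theorem zDer_X_sub_X (k : ℕ) (a b : Fin r) : zDer r k (X a - X b) = hTwo k a b * (X a - X b) := by
  rw [map_sub, zDer_X, zDer_X, hTwo]
  have h := geom_sum₂_mul (X a : ZRing r) (X b) (k + 1)
  rw [← h]
  refine congrArg (· * _) (Finset.sum_congr rfl fun e he => ?_)
  rw [Finset.mem_range] at he
  rw [show k + 1 - 1 - e = k - e by omega]

/-- A derivation acting diagonally on the factors of a product acts diagonally on the product, with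
the sum of the eigenvalues. [folklore] -/
theorem derivation_prod_of_eigen {A : Type*} [CommRing A] [Algebra ℂ A] (D : Derivation ℂ A A) {ι : Type*}
    (s : Finset ι) (F c : ι → A) (h : ∀ e ∈ s, D (F e) = c e * F e) :
    D (∏ e ∈ s, F e) = (∑ e ∈ s, c e) * ∏ e ∈ s, F e := by
  classical
  induction s using Finset.induction_on with
  | empty => simp
  | insert a s ha ih =>
    rw [Finset.prod_insert ha, Finset.sum_insert ha, Derivation.leibniz, smul_eq_mul, smul_eq_mul,
      ih fun e he => h e (Finset.mem_insert_of_mem he), h a (Finset.mem_insert_self a s)]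
    ring

/-- The Vandermonde product `Δ = ∏_{i<j} (z_i - z_j)`. [folklore] -/
def vand (r : ℕ) : ZRing r := ∏ i : Fin r, ∏ j ∈ Finset.univ.filter (fun j => i < j), (X i - X j)

/-- `e_k = Σ_{i<j} h_k(z_i, z_j)`. [folklore] -/
def eTwo (r k : ℕ) : ZRing r := ∑ i : Fin r, ∑ j ∈ Finset.univ.filter (fun j => i < j), hTwo k i j

/-- `D_k Δ = e_k Δ`. [folklore] -/
theorem zDer_vand (k : ℕ) : zDer r k (vand r) = eTwo r k * vand r := by
  rw [vand, eTwo]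
  refine derivation_prod_of_eigen _ _ _ _ fun i _ => ?_
  exact derivation_prod_of_eigen _ _ _ _ fun j _ => zDer_X_sub_X k i j

/-- `D_k Δⁿ = n e_k Δⁿ`. [folklore] -/
theorem zDer_vand_pow (k n : ℕ) : zDer r k (vand r ^ n) = (n : ZRing r) * eTwo r k * vand r ^ n := by
  rw [Derivation.leibniz_pow, zDer_vand, smul_eq_mul, nsmul_eq_mul]
  rcases Nat.eq_zero_or_pos n with rfl | hn
  · simp
  · rw [show vand r ^ n = vand r ^ (n - 1) * vand r by rw [← pow_succ, Nat.sub_add_cancel hn]]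
    ring

/-- `h_k(z_a, z_b) = h_k(z_b, z_a)`. [folklore] -/
theorem hTwo_comm (k : ℕ) (a b : Fin r) : hTwo k a b = hTwo k b a := by
  rw [hTwo, hTwo, ← Finset.sum_range_reflect]
  refine Finset.sum_congr rfl fun e he => ?_
  rw [Finset.mem_range] at he
  rw [show k + 1 - 1 - e = k - e by omega, show k - (k - e) = e by omega, mul_comm]

/-- `h_k(z_a, z_a) = (k + 1) z_a^k`. [folklore] -/
theorem hTwo_self (k : ℕ) (a : Fin r) : hTwo k a a = ((k : ZRing r) + 1) * X a ^ k := by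
  rw [hTwo]
  have h : ∀ e ∈ Finset.range (k + 1), (X a ^ e * X a ^ (k - e) : ZRing r) = X a ^ k := by
    intro e he
    rw [Finset.mem_range] at he
    rw [← pow_add, show e + (k - e) = k by omega]
  rw [Finset.sum_congr rfl h, Finset.sum_const, Finset.card_range, nsmul_eq_mul]
  push_cast
  ring

/-- **Power-sum expansion of `e_k`**: `2 e_k = Σ_{a=0}^{k} p_a p_{k-a} - (k + 1) p_k`. [folklore] -/
theorem two_mul_eTwo (k : ℕ) :
    2 * eTwo r k = ∑ a ∈ Finset.range (k + 1), psum (Fin r) ℂ a * psum (Fin r) ℂ (k - a) -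
      ((k : ZRing r) + 1) * psum (Fin r) ℂ k := by
  -- `Σ_a p_a p_{k-a} = Σ_i Σ_j h_k(z_i, z_j)`
  have h1 : ∑ a ∈ Finset.range (k + 1), psum (Fin r) ℂ a * psum (Fin r) ℂ (k - a) =
      ∑ i : Fin r, ∑ j : Fin r, hTwo k i j := by
    simp only [psum, Finset.sum_mul, Finset.mul_sum, hTwo]
    rw [Finset.sum_comm]
    refine Finset.sum_congr rfl fun i _ => ?_
    rw [Finset.sum_comm]
    exact Finset.sum_congr rfl fun j _ => hTwo_comm k j i
  -- split the inner sum at `j < i`, `j = i`, `j > i`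
  have h2 : ∀ i : Fin r, ∑ j : Fin r, hTwo k i j =
      ∑ j ∈ Finset.univ.filter (fun j => j < i), hTwo k i j + (hTwo k i i +
        ∑ j ∈ Finset.univ.filter (fun j => i < j), hTwo k i j) := by
    intro i
    rw [← Finset.sum_filter_add_sum_filter_not Finset.univ (fun j => j < i)]
    congr 1
    rw [← Finset.sum_filter_add_sum_filter_not (Finset.univ.filter fun j => ¬j < i) (fun j => j = i)]
    congr 1
    · have : (Finset.univ.filter fun j : Fin r => ¬j < i).filter (fun j => j = i) = {i} := by
        ext j
        simp only [Finset.mem_filter, Finset.mem_univ, true_and, Finset.mem_singleton]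
        constructor
        · rintro ⟨-, rfl⟩; rfl
        · rintro rfl; exact ⟨lt_irrefl _, rfl⟩
      rw [this, Finset.sum_singleton]
    · refine Finset.sum_congr ?_ fun _ _ => rfl
      ext j
      simp only [Finset.mem_filter, Finset.mem_univ, true_and]
      constructor
      · rintro ⟨h1, h2⟩; exact lt_of_le_of_ne (not_lt.mp h1) (Ne.symm h2)
      · intro h; exact ⟨not_lt.mpr h.le, h.ne'⟩
  -- the `j < i` part is `e_k` again, by symmetry
  have h3 : ∑ i : Fin r, ∑ j ∈ Finset.univ.filter (fun j => j < i), hTwo k i j = eTwo r k := by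
    rw [eTwo, Finset.sum_comm' (t' := Finset.univ) (s' := fun j => Finset.univ.filter fun i => j < i)]
    · exact Finset.sum_congr rfl fun j _ => Finset.sum_congr rfl fun i _ => hTwo_comm k i j
    · intro i j
      simp only [Finset.mem_filter, Finset.mem_univ, true_and, and_true]
  rw [h1, Finset.sum_congr rfl fun i _ => h2 i, Finset.sum_add_distrib, Finset.sum_add_distrib, h3, ← eTwo,
    Finset.sum_congr rfl fun i _ => hTwo_self k i, ← Finset.mul_sum, ← psum]
  ring

/-- `D_k` of a monomial. [folklore] -/
theorem zDer_monomial (k : ℕ) (u : Fin r →₀ ℕ) (a : ℂ) :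
    zDer r k (monomial u a) = ∑ i ∈ u.support, monomial (u + Finsupp.single i k) (a * u i) := by
  rw [zDer, mkDerivation_monomial, Finsupp.sum, Finset.smul_sum]
  refine Finset.sum_congr rfl fun i hi => ?_
  rw [Finsupp.mem_support_iff] at hi
  have hexp : u - Finsupp.single i 1 + Finsupp.single i (k + 1) = u + Finsupp.single i k := by
    ext j
    simp only [Finsupp.coe_add, Finsupp.coe_tsub, Pi.add_apply, Pi.sub_apply, Finsupp.single_apply]
    split_ifs with h
    · subst h; omega
    · omega
  rw [X_pow_eq_monomial, smul_eq_mul, monomial_mul, mul_one, smul_monomial, smul_eq_mul, hexp]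

/-- **The coefficients of `D_k f`**: `[z^γ] (Σ_i z_i^{k+1} ∂_i f) = Σ_i [k ≤ γ_i] (γ_i - k) [z^{γ - k e_i}] f`. [folklore] -/
theorem coeff_zDer (k : ℕ) (f : ZRing r) (γ : Fin r →₀ ℕ) :
    coeff γ (zDer r k f) =
      ∑ i : Fin r, if k ≤ γ i then ((γ i - k : ℕ) : ℂ) * coeff (γ - Finsupp.single i k) f else 0 := by
  classical
  induction f using MvPolynomial.induction_on' with
  | monomial u a =>
    rw [zDer_monomial, coeff_sum]
    -- extend the sum to all `i` (the terms with `u i = 0` vanish)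
    have hzero : ∀ i ∈ (Finset.univ : Finset (Fin r)), i ∉ u.support →
        coeff γ (monomial (u + Finsupp.single i k) (a * u i)) = 0 := by
      intro i _ hi
      rw [Finsupp.mem_support_iff, not_not] at hi
      rw [hi, Nat.cast_zero, mul_zero, map_zero, coeff_zero]
    rw [Finset.sum_subset (Finset.subset_univ u.support) hzero]
    refine Finset.sum_congr rfl fun i _ => ?_
    rw [coeff_monomial, coeff_monomial]
    by_cases h : u + Finsupp.single i k = γ
    · have hk : k ≤ γ i := by rw [← h]; simp
      have hu : u = γ - Finsupp.single i k := by rw [← h]; ext j; simp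
      have hγ : γ i - k = u i := by rw [← h]; simp
      rw [if_pos h, if_pos hk, if_pos hu, hγ, mul_comm]
    · rw [if_neg h]
      split_ifs with hk hu
      · exfalso; apply h; rw [hu]; ext j
        simp only [Finsupp.coe_add, Finsupp.coe_tsub, Pi.add_apply, Pi.sub_apply, Finsupp.single_apply]
        split_ifs with hij
        · subst hij; omega
        · omega
      · rw [mul_zero]
      · rfl
  | add f g hf hg =>
    rw [map_add, coeff_add, hf, hg, ← Finset.sum_add_distrib]
    refine Finset.sum_congr rfl fun i _ => ?_
    split_ifs
    · rw [coeff_add, mul_add]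
    · rw [add_zero]

/-- **The coefficients of `p_k f`**: `[z^γ] (p_k f) = Σ_i [k ≤ γ_i] [z^{γ - k e_i}] f`. [folklore] -/
theorem coeff_psum_mul (k : ℕ) (f : ZRing r) (γ : Fin r →₀ ℕ) :
    coeff γ (psum (Fin r) ℂ k * f) = ∑ i : Fin r, if k ≤ γ i then coeff (γ - Finsupp.single i k) f else 0 := by
  rw [psum, Finset.sum_mul, coeff_sum]
  refine Finset.sum_congr rfl fun i _ => ?_
  rw [X_pow_eq_monomial, coeff_monomial_mul', one_mul]
  by_cases h : k ≤ γ i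
  · rw [if_pos (Finsupp.single_le_iff.mpr h), if_pos h]
  · rw [if_neg (fun h' => h (Finsupp.single_le_iff.mp h')), if_neg h]

/-- The constant exponent vector `(g, …, g)`. [folklore] -/
def constExp (r g : ℕ) : Fin r →₀ ℕ := Finsupp.equivFunOnFinite.symm fun _ => g

/-- The constant exponent vector takes the value `g`. [folklore] -/
@[simp] theorem constExp_apply (g : ℕ) (i : Fin r) : constExp r g i = g := rfl

/-- **The residue of a total derivative vanishes** (coefficient form): at the constant exponent
`γ = (g, …, g)`, `[z^γ] (D_k f + (k - g) p_k f) = Σ_i ((g - k) + (k - g)) [z^{γ - k e_i}] f = 0`. [folklore] -/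
theorem coeff_constExp_zDer_add (k g : ℕ) (f : ZRing r) :
    coeff (constExp r g) (zDer r k f) + coeff (constExp r g) ((((k : ℂ) - g) • psum (Fin r) ℂ k) * f) = 0 := by
  rw [smul_mul_assoc, coeff_smul, coeff_zDer, coeff_psum_mul, smul_eq_mul, Finset.mul_sum,
    ← Finset.sum_add_distrib]
  refine Finset.sum_eq_zero fun i _ => ?_
  simp only [constExp_apply]
  split_ifs with h
  · rw [Nat.cast_sub h]; ring
  · rw [mul_zero, add_zero]

end ZRing

/-! ### Weighted homogeneity (the level grading of the Fock space) -/

section Level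

variable [Algebra ℂ R]

/-- The level weights `deg x_n = n`. [cite: IoharaKoga2011, §4.2.1 (grading of F^η)] -/
abbrev lw : ℕ+ → ℕ := fun n => (n : ℕ)

omit [Algebra ℂ R] in
/-- Transport of weighted homogeneity along an equality of degrees. [folklore] -/
theorem isWH_of_eq {v : Space R} {N N' : ℕ} (h : IsWeightedHomogeneous lw v N) (e : N = N') :
    IsWeightedHomogeneous lw v N' := e ▸ h

omit [Algebra ℂ R] in
/-- The creation letters are homogeneous: `deg x_n = n`. [folklore] -/
theorem isWeightedHomogeneous_x (n : ℕ) : IsWeightedHomogeneous lw (x R n) n := by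
  by_cases hn : 0 < n
  · rw [x_of_pos hn]
    exact isWeightedHomogeneous_X R lw ⟨n, hn⟩
  · rw [show n = 0 by omega, x_zero]
    exact isWeightedHomogeneous_zero R lw 0

/-- **The coherent family is graded**: `E_N` has level `N`. [folklore] -/
theorem isWeightedHomogeneous_E (q : ℕ → R) (N : ℕ) : IsWeightedHomogeneous lw (E q N) N := by
  induction N using Nat.strong_induction_on with
  | _ N ih =>
  cases N with
  | zero => rw [E_zero]; exact isWeightedHomogeneous_one R lw
  | succ N =>
    rw [E_succ]
    refine isWH_of_eq ((isWeightedHomogeneous_C lw _).mul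
      (IsWeightedHomogeneous.sum _ _ (N + 1) fun m hm => ?_)) (by omega)
    rw [Finset.mem_range] at hm
    exact isWH_of_eq (((isWeightedHomogeneous_C lw _).mul (isWeightedHomogeneous_x (m + 1))).mul
      (ih (N - m) (by omega))) (by omega)

omit [Algebra ℂ R] in
/-- `C a · v` has the level of `v`. [folklore] -/
theorem isWH_C_mul {v : Space R} {N : ℕ} (a : R) (h : IsWeightedHomogeneous lw v N) :
    IsWeightedHomogeneous lw (C a * v) N :=
  isWH_of_eq ((isWeightedHomogeneous_C lw a).mul h) (zero_add N)

omit [Algebra ℂ R] in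
/-- Coefficientwise maps preserve the level. [folklore] -/
theorem isWH_coeffMapₗ {R' : Type*} [CommRing R'] {S : Type*} [CommSemiring S] [Module S R]
    [Module S R'] (φ : R →ₗ[S] R') {v : Space R} {N : ℕ} (h : IsWeightedHomogeneous lw v N) :
    IsWeightedHomogeneous lw (coeffMapₗ φ v) N := by
  intro d hd
  rw [coeff_coeffMapₗ] at hd
  exact h fun h0 => hd (by rw [h0, map_zero])

variable (lam mu : R)

omit [Algebra ℂ R] in
/-- The Euler derivation `D_0` on monomials: `D_0 x^s = (Σ n s_n) x^s`. [cite: IoharaKoga2011, §4.2.1] -/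
theorem D_zero_monomial (s : ℕ+ →₀ ℕ) (a : R) :
    D R lam mu 0 (monomial s a) = ((Finsupp.weight lw s : ℕ) : R) • monomial s a := by
  have hdc : ∀ i : ℕ+, dc R lam mu 0 i = ((i : ℕ) : R) • X i := fun i => by
    rw [← mkDerivation_X R (dc R lam mu 0) i]
    change D R lam mu 0 (X i) = _
    have hx : x R (i : ℕ) = X i := by rw [x_of_pos i.pos]; rfl
    rw [← hx, D_zero_x]
  rw [D, mkDerivation_monomial, Finsupp.sum]
  have hterm : ∀ i ∈ s.support, (monomial (s - Finsupp.single i 1)) ((s i : ℕ) : R) • dc R lam mu 0 i =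
      (((s i : ℕ) : R) * ((i : ℕ) : R)) • monomial s (1 : R) := by
    intro i hi
    rw [Finsupp.mem_support_iff] at hi
    rw [hdc i, smul_eq_mul, mul_smul_comm, X, monomial_mul, mul_one, Finsupp.sub_add_single_one_cancel hi,
      smul_monomial, smul_monomial, smul_eq_mul, smul_eq_mul, mul_one, mul_comm]
  rw [Finset.sum_congr rfl hterm, ← Finset.sum_smul, smul_smul, Finsupp.weight_apply, Finsupp.sum, Nat.cast_sum,
    smul_monomial, smul_monomial, smul_eq_mul, mul_one, smul_eq_mul]
  congr 1
  rw [Finset.mul_sum, Finset.sum_mul]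
  refine Finset.sum_congr rfl fun i _ => ?_
  simp only [lw, smul_eq_mul, Nat.cast_mul]
  ring

/-- **`L_0` is the level operator**: on a vector of level `N`, `L_0 = h + N` (`h = ½μ² - λμ`).
[cite: IoharaKoga2011, §4.2.1 (grading of F^η) and eq. (4.4)] -/
theorem L_zero_of_isWeightedHomogeneous {v : Space R} {N : ℕ} (hv : IsWeightedHomogeneous lw v N) :
    L R lam mu 0 v = (hval R lam mu + N) • v := by
  have hD : D R lam mu 0 v = (N : R) • v := by
    conv_lhs => rw [v.as_sum]
    rw [map_sum]
    have h : ∀ t ∈ v.support, D R lam mu 0 (monomial t (coeff t v)) = (N : R) • monomial t (coeff t v) := by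
      intro t ht
      rw [D_zero_monomial, hv (MvPolynomial.mem_support_iff.mp ht)]
    rw [Finset.sum_congr rfl h, ← Finset.smul_sum, ← v.as_sum]
  simp only [L, LinearMap.add_apply, LinearMap.mulLeft_apply, Derivation.coeFn_coe, if_true, LinearMap.smul_apply,
    Module.End.one_apply, Int.toNat_zero, aa_zero, P_of_nonneg lam mu (le_refl (0 : ℤ)), zero_mul, zero_add,
    add_zero, hD, add_smul, add_comm]

end Level

/-! ### The screened vectors `Res_{z_1} ⋯ Res_{z_r} V_β(z_1) ⋯ V_β(z_r) |μ'⟩` for `β² ∈ 2ℕ` -/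

section Screening

variable {r : ℕ}

/-- The coherent data `q_n = β p_n(z) = β Σ_i z_iⁿ` of the product of `r` vertex operators
`V_β(z_1) ⋯ V_β(z_r)`. [cite: IoharaKoga2011, §4.3.1] -/
def qSeq (r : ℕ) (β : ℂ) (n : ℕ) : ZRing r := β • psum (Fin r) ℂ n

/-- **The screened family** `H_N = Δ(z)^{2p} E_N(β p(z)) ∈ ℂ[z][x]`: for `β² = 2p` the level-`N`
creation part of `V_β(z_1) ⋯ V_β(z_r) |μ - rβ⟩ = ∏_{i<j} (z_i - z_j)^{β²} ∏_i z_i^{β(μ - rβ)} exp(β Σ_n p_n(z) a_{-n}/n) |μ⟩`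
(up to the monomial prefactor `∏ z_i^{β(μ-rβ)}`, absorbed below in the choice of the extracted
coefficient). [cite: IoharaKoga2011, Lemma 4.6, eq. (4.11)] -/
def screenedFamily (r p : ℕ) (β : ℂ) (N : ℕ) : Space (ZRing r) := C (vand r ^ (2 * p)) * E (qSeq r β) N

/-- The extraction of the coefficient of `z_1^g ⋯ z_r^g` (an iterated residue after the shift by the
monomial prefactor). [folklore] -/
def extract (r g : ℕ) : Space (ZRing r) →ₗ[ℂ] Space ℂ := coeffMapₗ (lcoeff ℂ (constExp r g))

/-- **The screened vector** `u = [z_1^g ⋯ z_r^g] Δ(z)^{2p} E_N(β p(z)) ∈ ℂ[x₁, x₂, …]`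
(`= Res_{z_1} ⋯ Res_{z_r} V_β(z_1) ⋯ V_β(z_r) |μ - rβ⟩` at level `N` for the appropriate `g`).
[cite: IoharaKoga2011, §4.3.1 (Σ_μ := V_μ(0)) and Lemma 4.8 (coefficient extraction from (4.13))] -/
def screeningVector (r p : ℕ) (β : ℂ) (g N : ℕ) : Space ℂ := extract r g (screenedFamily r p β N)

/-- The derivations `D_k` on the coherent data: `(1/n) D_k q_n = q_{n+k}`. [folklore] -/
theorem ninv_mul_zDer_qSeq (β : ℂ) (k n : ℕ) (hn : 0 < n) :
    ninv (ZRing r) n * zDer r k (qSeq r β n) = qSeq r β (n + k) := by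
  rw [qSeq, qSeq, Algebra.smul_def, Algebra.smul_def, Derivation.leibniz, Derivation.map_algebraMap, smul_zero,
    add_zero, smul_eq_mul, zDer_psum]
  calc ninv (ZRing r) n * (algebraMap ℂ (ZRing r) β * ((n : ZRing r) * psum (Fin r) ℂ (n + k)))
      = algebraMap ℂ (ZRing r) β * psum (Fin r) ℂ (n + k) * ((n : ZRing r) * ninv (ZRing r) n) := by ring
    _ = algebraMap ℂ (ZRing r) β * psum (Fin r) ℂ (n + k) := by rw [natCast_mul_ninv (by omega), mul_one]

/-- **The scalar identity behind `[L_k, V_β(z)] = ∂_z(z^{k+1} V_β(z))`**: for `β² = 2p`,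
`βλ = p - 1` (conformal weight `h_β = 1`), `βμ = (r+1)p - (s+1)` and `g = (r-1)p + s`,
`Δ^{2p} S_k = D_k(Δ^{2p}) + (k - g) p_k Δ^{2p}` in `ℂ[z_1, …, z_r]`.
[cite: IoharaKoga2011, Lemma 4.4 and Lemma 4.5] -/
theorem vand_pow_mul_coherentScalar (p s g : ℕ) {β lam mu : ℂ} (hβ : β ^ 2 = 2 * p) (hl : β * lam = p - 1)
    (hm : β * mu = (r + 1) * p - (s + 1)) (hg : (g : ℂ) + p = r * p + s) {k : ℕ} (hk : 0 < k) :
    vand r ^ (2 * p) * coherentScalar (algebraMap ℂ _ lam) (algebraMap ℂ _ mu) (qSeq r β) k =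
      zDer r k (vand r ^ (2 * p)) + (((k : ℂ) - g) • psum (Fin r) ℂ k) * vand r ^ (2 * p) := by
  -- the power-sum expansion of `D_k Δ^{2p} = 2p e_k Δ^{2p}`
  have hsum : ∑ a ∈ Finset.range (k + 1), psum (Fin r) ℂ a * psum (Fin r) ℂ (k - a) =
      ∑ i ∈ Finset.range (k - 1), psum (Fin r) ℂ (i + 1) * psum (Fin r) ℂ (k - 1 - i) +
        2 * r * psum (Fin r) ℂ k := by
    rw [Finset.sum_range_succ, Nat.sub_self]
    obtain ⟨k', rfl⟩ : ∃ k', k = k' + 1 := ⟨k - 1, by omega⟩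
    rw [Finset.sum_range_succ', Nat.sub_zero, psum_zero, Fintype.card_fin]
    have e : ∀ i ∈ Finset.range k', psum (Fin r) ℂ (i + 1) * psum (Fin r) ℂ (k' + 1 - (i + 1)) =
        psum (Fin r) ℂ (i + 1) * psum (Fin r) ℂ (k' + 1 - 1 - i) := by
      intro i _; rw [show k' + 1 - (i + 1) = k' + 1 - 1 - i by omega]
    rw [Finset.sum_congr rfl e, Nat.add_sub_cancel]
    ring
  have hD : zDer r k (vand r ^ (2 * p)) =
      (p : ZRing r) * (∑ i ∈ Finset.range (k - 1), psum (Fin r) ℂ (i + 1) * psum (Fin r) ℂ (k - 1 - i) +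
        2 * r * psum (Fin r) ℂ k - ((k : ZRing r) + 1) * psum (Fin r) ℂ k) * vand r ^ (2 * p) := by
    rw [zDer_vand_pow, ← hsum, ← two_mul_eTwo]
    push_cast
    ring
  -- the relations among the scalars, transported to `ℂ[z]`
  set bR : ZRing r := algebraMap ℂ (ZRing r) β with hbR
  have e1 : bR ^ 2 = 2 * (p : ZRing r) := by
    rw [hbR, ← map_pow, hβ, map_mul, map_natCast, map_ofNat]
  have e2 : (2 : ZRing r) * half (ZRing r) = 1 := two_mul_half
  have e3 : bR * algebraMap ℂ (ZRing r) lam = (p : ZRing r) - 1 := by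
    rw [hbR, ← map_mul, hl, map_sub, map_natCast, map_one]
  have e4 : bR * algebraMap ℂ (ZRing r) mu = ((r : ZRing r) + 1) * p - ((s : ZRing r) + 1) := by
    rw [hbR, ← map_mul, hm]; simp
  have e5 : (g : ZRing r) + p = r * p + s := by
    have := congrArg (algebraMap ℂ (ZRing r)) hg
    simpa using this
  have hq : ∀ n, qSeq r β n = bR * psum (Fin r) ℂ n := fun n => Algebra.smul_def β _
  set Q := ∑ i ∈ Finset.range (k - 1), psum (Fin r) ℂ (i + 1) * psum (Fin r) ℂ (k - 1 - i) with hQ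
  have hQ' : ∑ i ∈ Finset.range (k - 1), qSeq r β (i + 1) * qSeq r β (k - 1 - i) = bR ^ 2 * Q := by
    rw [hQ, Finset.mul_sum]
    refine Finset.sum_congr rfl fun i _ => ?_
    rw [hq, hq]
    ring
  have hsm : (((k : ℂ) - g) • psum (Fin r) ℂ k) = ((k : ZRing r) - g) * psum (Fin r) ℂ k := by
    rw [Algebra.smul_def, map_sub, map_natCast, map_natCast]
  rw [hD, coherentScalar, hQ', hq k, hsm]
  linear_combination (vand r ^ (2 * p) * Q * half (ZRing r)) * e1 + (vand r ^ (2 * p) * Q * (p : ZRing r)) * e2 +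
    (vand r ^ (2 * p) * psum (Fin r) ℂ k) * e4 -
    (vand r ^ (2 * p) * psum (Fin r) ℂ k * ((k : ZRing r) + 1)) * e3 + (vand r ^ (2 * p) * psum (Fin r) ℂ k) * e5

/-- **The raising operators on the screened family** (`[L_k, V_β(z)]` is a total derivative for
`h_β = 1`): `L_k H_{N+k} = D_k H_N + (k - g) p_k H_N` with `D_k = Σ_i z_i^{k+1} ∂_{z_i}` acting on the
coefficients. [cite: IoharaKoga2011, Lemma 4.4, Lemma 4.5 and Lemma 4.6 (eq. (4.11))] -/
theorem L_screenedFamily (p s g : ℕ) {β lam mu : ℂ} (hβ : β ^ 2 = 2 * p) (hl : β * lam = p - 1)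
    (hm : β * mu = (r + 1) * p - (s + 1)) (hg : (g : ℂ) + p = r * p + s) {k : ℕ} (hk : 0 < k) (N : ℕ) :
    L (ZRing r) (algebraMap ℂ _ lam) (algebraMap ℂ _ mu) k (screenedFamily r p β (N + k)) =
      coeffMapₗ (zDer r k).toLinearMap (screenedFamily r p β N) +
        C (((k : ℂ) - g) • psum (Fin r) ℂ k) * screenedFamily r p β N := by
  rw [screenedFamily, screenedFamily, L_C_mul, L_pos_E _ _ _ hk, if_pos (Nat.le_add_left k N), Nat.add_sub_cancel,
    coeffMapₗ_C_mul_of_derivation, coeffMapₗ_derivation_E]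
  -- the creation sums agree: `(1/(m+1)) D_k q_{m+1} = q_{m+1+k}`
  have hs : ∑ m ∈ Finset.range N, C (ninv (ZRing r) (m + 1) * zDer r k (qSeq r β (m + 1))) * x (ZRing r) (m + 1) *
        E (qSeq r β) (N - 1 - m) =
      ∑ j ∈ Finset.range N, C (qSeq r β (j + 1 + k)) * x (ZRing r) (j + 1) * E (qSeq r β) (N - 1 - j) :=
    Finset.sum_congr rfl fun m _ => by rw [ninv_mul_zDer_qSeq β k (m + 1) (Nat.succ_pos m)]
  have key := vand_pow_mul_coherentScalar (r := r) p s g hβ hl hm hg hk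
  rw [hs, mul_add (C (vand r ^ (2 * p))), ← mul_assoc (C (vand r ^ (2 * p))), ← map_mul, key, map_add, map_mul,
    add_mul]
  ring

/-- The extraction intertwines the Feigin–Fuchs operators over `ℂ[z]` and over `ℂ`. [folklore] -/
theorem extract_L (g : ℕ) (lam mu : ℂ) (n : ℤ) (v : Space (ZRing r)) :
    extract r g (L (ZRing r) (algebraMap ℂ _ lam) (algebraMap ℂ _ mu) n v) = L ℂ lam mu n (extract r g v) := by
  rw [extract, coeffMapₗ_L, Algebra.algebraMap_self_apply, Algebra.algebraMap_self_apply]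

/-- **The residue of a total derivative vanishes**: the extraction kills `D_k v + (k - g) p_k v`. [folklore] -/
theorem extract_zDer_add (k g : ℕ) (v : Space (ZRing r)) :
    extract r g (coeffMapₗ (zDer r k).toLinearMap v) + extract r g (C (((k : ℂ) - g) • psum (Fin r) ℂ k) * v) = 0 := by
  refine MvPolynomial.ext _ _ fun t => ?_
  rw [coeff_add, coeff_zero, extract, coeff_coeffMapₗ, coeff_coeffMapₗ, coeff_coeffMapₗ_C_mul, lcoeff_apply,
    lcoeff_apply]
  exact coeff_constExp_zDer_add k g (coeff t v)

/-- The exponent `g = (r-1)p + s` of the extracted monomial satisfies `g + p = rp + s` (`r ≥ 1`). [folklore] -/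
theorem screeningExp_spec (p s : ℕ) (hr : 0 < r) : ((((r - 1) * p + s : ℕ)) : ℂ) + p = r * p + s := by
  obtain ⟨r', rfl⟩ : ∃ r', r = r' + 1 := ⟨r - 1, by omega⟩
  rw [Nat.add_sub_cancel]
  push_cast
  ring

/-- **The screened vector is annihilated by `Vir⁺`**: for `β² = 2p`, `βλ = p - 1`,
`βμ = (r+1)p - (s+1)` and all `k ≥ 1`, `L_k u = 0` where
`u = [z_1^g ⋯ z_r^g] Δ(z)^{2p} E_{rs}(β p(z))`, `g = (r-1)p + s`.
[cite: IoharaKoga2011, Lemma 4.5 and Lemma 4.11 (first display: (Σ_√N)^n.|η - n√N⟩ ∈ (F_λ^η)^{Vir⁺})] -/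
theorem L_pos_screeningVector (p s : ℕ) (hr : 0 < r) {β lam mu : ℂ} (hβ : β ^ 2 = 2 * p) (hl : β * lam = p - 1)
    (hm : β * mu = (r + 1) * p - (s + 1)) {k : ℕ} (hk : 0 < k) :
    L ℂ lam mu k (screeningVector r p β ((r - 1) * p + s) (r * s)) = 0 := by
  rw [screeningVector, ← extract_L]
  by_cases hkN : k ≤ r * s
  · obtain ⟨N, hN⟩ : ∃ N, r * s = N + k := ⟨r * s - k, by omega⟩
    rw [hN, L_screenedFamily p s _ hβ hl hm (screeningExp_spec p s hr) hk N, map_add, extract_zDer_add]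
  · rw [screenedFamily, L_C_mul, L_pos_E _ _ _ hk, if_neg hkN, mul_zero, map_zero]

/-- The screened vector has level `N`. [folklore] -/
theorem isWeightedHomogeneous_screeningVector (p : ℕ) (β : ℂ) (g N : ℕ) :
    IsWeightedHomogeneous lw (screeningVector r p β g N) N :=
  isWH_coeffMapₗ _ (isWH_C_mul _ (isWeightedHomogeneous_E _ N))

/-- **Singular vectors of Fock modules from screenings of even integral square.** Let `p, r ≥ 1`,
`s ≥ 0`, `β² = 2p`, `λ = β/2 - 1/β` (so `c_λ = 1 - 12λ² = 13 - 6p - 6/p = c(p)`) and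
`βμ = (r+1)p - (s+1)` (so `h = ½μ(μ - 2λ) = h_{r,s}(p)`). Then the screened vector
`u = Res_{z_1} ⋯ Res_{z_r} V_β(z_1) ⋯ V_β(z_r) |μ - rβ⟩ ∈ F_λ^μ` is annihilated by `Vir⁺` and has
`L_0`-weight `h + rs`: it is a singular vector of level `rs` of the Fock module `F_λ^μ` as soon as it is
non-zero (`Literature.RepresentationTheory.Virasoro.FockSingularVectorsNonzero`).
[cite: IoharaKoga2011, Lemma 4.11 (proof, first two displays) with Lemmas 4.5–4.6] -/
theorem screeningVector_singular (p s : ℕ) (hr : 0 < r) {β lam mu : ℂ} (hβ : β ^ 2 = 2 * p)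
    (hl : β * lam = p - 1) (hm : β * mu = (r + 1) * p - (s + 1)) :
    (∀ n : ℤ, 0 < n → (rep (R := ℂ) lam mu).L n (screeningVector r p β ((r - 1) * p + s) (r * s)) = 0) ∧
      (rep (R := ℂ) lam mu).L 0 (screeningVector r p β ((r - 1) * p + s) (r * s)) =
        (mu * (mu - 2 * lam) / 2 + (r * s : ℕ)) • screeningVector r p β ((r - 1) * p + s) (r * s) := by
  constructor
  · intro n hn
    obtain ⟨k, rfl⟩ : ∃ k : ℕ, n = k := ⟨n.toNat, by omega⟩
    rw [rep_L_apply, Algebra.algebraMap_self_apply]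
    exact L_pos_screeningVector p s hr hβ hl hm (by exact_mod_cast hn)
  · rw [rep_L_apply, Algebra.algebraMap_self_apply,
      L_zero_of_isWeightedHomogeneous lam mu (isWeightedHomogeneous_screeningVector p β _ _), hval, half,
      Algebra.algebraMap_self_apply]
    congr 1
    ring

end Screening

end Fock

end Literature.RepresentationTheory.Virasoro

end
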